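import Literature.NumberTheory.LFunctions.DirichletLDerivativeExplicitBound
import HarnessLib

/-!
# `L'(σ, χ)` for a non-principal `χ` with bounded character sums:
# `‖L'(σ, χ)‖ ≤ N^{1−σ}(½ log²N + c log N + c + (c + log N)/σ + 1/σ²)`, `N = ⌈B⌉`, `|Σ_{m≤n} χ(m)| ≤ B`

Topic `Literature/NumberTheory/LFunctions` (continuing `DirichletLDerivativeExplicitBound.lean`, whose
`norm_deriv_LFunction_ofReal_le` is the case `χ` primitive, `B = √q(1 + log q)`). Everything in this file
is PROVED (theorems only; no definition, no named fact).

For a Dirichlet character `χ ≠ χ₀` mod `q` whose partial sums satisfy `|S(n)| ≤ B` for all `n`, with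
`B ≥ 1`, the Abel series `L'(s, χ) = ∑ S(n+1) d/ds((n+1)^{-s} − (n+2)^{-s})` of the tree
(`deriv_LFunction_eq_tsum`) split at `N = ⌈B⌉` (trivial bound `|S(k)| ≤ k` below `N`, `|S| ≤ B ≤ N`
above) gives, for real `0 < σ ≤ 1`, exactly the bound of the primitive case with this `N`:

* `norm_deriv_LFunction_ofReal_le_of_partialSum_le` —
  `‖L'(σ, χ)‖ ≤ N^{1−σ}·(½ log²N + c log N + c + (c + log N)/σ + 1/σ²)`, `c = 1 + log 2`;
* `norm_deriv_LFunction_le_near_one_of_partialSum_le` — for `r < 1`, `σ ∈ [1 − r, 1]` the same with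
  `N^{r}`, `1/(1 − r)`, `1/(1 − r)²`.

With the tree's Pólya–Vinogradov inequality for EVERY non-principal character
(`LargeSieve.polyaVinogradov_of_ne_one_Icc`, `B ≍ √q log q`) this is `‖L'(σ, χ)‖ ≤ (⅛ + o(1)) q^{(1−σ)/2+o(1)}
log² q` for imprimitive `χ` too — the input of Page's step `L(1, χ_D)/δ ≤ log²D` for an arbitrary real
non-principal `χ_D` (Pintz 1976 IV (4.1)). The method is Montgomery–Vaughan's Exercise 11.2.3 (b).

## References

* H. L. Montgomery, R. C. Vaughan, *Multiplicative Number Theory I*, CUP 2007, §4.3 (4.23), §11.2.1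
  Exercise 3 (b). [MontgomeryVaughan2007]
* J. Pintz, Acta Arith. 31 (1976) 419–429, §4 (4.1). [Pintz1976ElementaryIV]
-/

noncomputable section

open Complex Filter Topology Finset Set

namespace Literature.NumberTheory.LFunctions.DirichletAbel

variable {q : ℕ} [NeZero q] (χ : DirichletCharacter ℂ q)

/-- `1 + log(x + 1) ≤ (1 + log 2) + log x` for `x ≥ 1` (`x + 1 ≤ 2x`). [folklore] -/
private theorem one_add_log_add_one_le' {x : ℝ} (hx : 1 ≤ x) :
    1 + Real.log (x + 1) ≤ (1 + Real.log 2) + Real.log x := by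
  have h : Real.log (x + 1) ≤ Real.log (2 * x) := Real.log_le_log (by linarith) (by linarith)
  rw [Real.log_mul (by norm_num) (by linarith)] at h
  linarith

/-- **Explicit bound for `L'(σ, χ)`, `0 < σ ≤ 1`, from a partial-sum bound**: for `χ ≠ χ₀` mod `q`
with `|Σ_{m ≤ n} χ(m)| ≤ B` for all `n` (`B ≥ 1`),
`‖L'(σ, χ)‖ ≤ N^{1−σ}·(½ log²N + c log N + c + (c + log N)/σ + 1/σ²)` with `N = ⌈B⌉` and
`c = 1 + log 2` (Abel summation, `|S(k)| ≤ min(k, B)`, integral comparison).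
[cite: MontgomeryVaughan2007, §11.2.1 Exercise 3 (b)] -/
theorem norm_deriv_LFunction_ofReal_le_of_partialSum_le (hne : χ ≠ 1) {B : ℝ} (hB1 : 1 ≤ B)
    (hB : ∀ n, ‖partialSum χ n‖ ≤ B) {σ : ℝ} (hσ0 : 0 < σ) (hσ1 : σ ≤ 1) :
    ‖deriv χ.LFunction σ‖ ≤
      (⌈B⌉₊ : ℝ) ^ (1 - σ) *
        (Real.log ⌈B⌉₊ ^ 2 / 2 + (1 + Real.log 2) * Real.log ⌈B⌉₊ + (1 + Real.log 2) +
          ((1 + Real.log 2) + Real.log ⌈B⌉₊) / σ + 1 / σ ^ 2) := by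
  set N : ℕ := ⌈B⌉₊ with hNdef
  set c : ℝ := 1 + Real.log 2 with hc
  have hB0 : 0 < B := by linarith
  have hBN : B ≤ N := Nat.le_ceil B
  have hN1 : 1 ≤ N := Nat.ceil_pos.2 hB0
  have hN1r : (1 : ℝ) ≤ N := by exact_mod_cast hN1
  have hN0r : (0 : ℝ) < N := by linarith
  have hlogN : 0 ≤ Real.log N := Real.log_nonneg hN1r
  have hc1 : 1 ≤ c := by
    have := Real.log_nonneg (show (1 : ℝ) ≤ 2 by norm_num); rw [hc]; linarith
  have hs : 0 < ((σ : ℂ)).re := by simp [hσ0]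
  have hnorm_s : ‖(σ : ℂ)‖ = σ := by rw [Complex.norm_real, Real.norm_of_nonneg hσ0.le]
  -- the Abel series for `L'` and its termwise bound
  rw [deriv_LFunction_eq_tsum χ hne hs]
  set F : ℕ → ℝ := fun n => ‖deriv (term χ n) (σ : ℂ)‖ with hF
  have hterm : ∀ n : ℕ, F n ≤ ‖partialSum χ (n + 1)‖ *
      ((1 + Real.log ((n : ℝ) + 2)) * ((n : ℝ) + 1) ^ (-σ - 1)) := by
    intro n
    have h := norm_deriv_term_le χ n hs
    rw [hnorm_s, Complex.ofReal_re] at h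
    refine h.trans (mul_le_mul_of_nonneg_left ?_ (norm_nonneg _))
    have hlog : 0 ≤ Real.log ((n : ℝ) + 2) := Real.log_nonneg (by linarith [n.cast_nonneg (α := ℝ)])
    have hpow : 0 ≤ ((n : ℝ) + 1) ^ (-σ - 1) := Real.rpow_nonneg (by positivity) _
    apply mul_le_mul_of_nonneg_right _ hpow
    nlinarith
  have hFsum : Summable F := by
    refine Summable.of_nonneg_of_le (fun n => norm_nonneg _) (fun n => (hterm n).trans ?_)
      ((summable_log_mul_rpow hσ0 zero_le_one).mul_left B)
    rw [one_mul]
    have hlog : 0 ≤ Real.log ((n : ℝ) + 2) := Real.log_nonneg (by linarith [n.cast_nonneg (α := ℝ)])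
    exact mul_le_mul_of_nonneg_right (hB (n + 1)) (by positivity)
  refine (norm_tsum_le_tsum_norm hFsum).trans ?_
  change ∑' n, F n ≤ _
  rw [← hFsum.sum_add_tsum_nat_add N]
  -- HEAD: `n < N`, trivial bound `|S(n+1)| ≤ n+1`
  have hhead : ∑ n ∈ range N, F n ≤
      (N : ℝ) ^ (1 - σ) * (c + c * Real.log N + Real.log N ^ 2 / 2) := by
    have hpt : ∀ n ∈ range N, F n ≤
        (N : ℝ) ^ (1 - σ) * ((c + Real.log ((n : ℝ) + 1)) / ((n : ℝ) + 1)) := by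
      intro n hn
      rw [Finset.mem_range] at hn
      have hn1 : (1 : ℝ) ≤ (n : ℝ) + 1 := by linarith [n.cast_nonneg (α := ℝ)]
      have hn0 : (0 : ℝ) < (n : ℝ) + 1 := by linarith
      have hnN : (n : ℝ) + 1 ≤ N := by exact_mod_cast (show n + 1 ≤ N by omega)
      refine (hterm n).trans ?_
      have hS : ‖partialSum χ (n + 1)‖ ≤ (n : ℝ) + 1 := by
        have := norm_partialSum_le_self χ (n + 1); push_cast at this; exact this
      have hlog2 : 1 + Real.log ((n : ℝ) + 2) ≤ c + Real.log ((n : ℝ) + 1) := by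
        have := one_add_log_add_one_le' hn1; rw [hc]; convert this using 2; ring_nf
      have hpow : 0 ≤ ((n : ℝ) + 1) ^ (-σ - 1) := Real.rpow_nonneg hn0.le _
      have hlog0 : 0 ≤ 1 + Real.log ((n : ℝ) + 2) := by
        have := Real.log_nonneg (show (1 : ℝ) ≤ (n : ℝ) + 2 by linarith); linarith
      have hsplit : ((n : ℝ) + 1) * ((n : ℝ) + 1) ^ (-σ - 1) =
          ((n : ℝ) + 1) ^ (1 - σ) / ((n : ℝ) + 1) := by
        rw [eq_div_iff hn0.ne', show -σ - 1 = (1 - σ) - 1 - 1 by ring, Real.rpow_sub_one hn0.ne',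
          Real.rpow_sub_one hn0.ne']
        field_simp
      have hmono : ((n : ℝ) + 1) ^ (1 - σ) ≤ (N : ℝ) ^ (1 - σ) :=
        Real.rpow_le_rpow hn0.le hnN (by linarith)
      calc ‖partialSum χ (n + 1)‖ * ((1 + Real.log ((n : ℝ) + 2)) * ((n : ℝ) + 1) ^ (-σ - 1))
          ≤ ((n : ℝ) + 1) * ((c + Real.log ((n : ℝ) + 1)) * ((n : ℝ) + 1) ^ (-σ - 1)) := by
            apply mul_le_mul hS (mul_le_mul_of_nonneg_right hlog2 hpow) (by positivity) hn0.le
        _ = ((n : ℝ) + 1) ^ (1 - σ) / ((n : ℝ) + 1) * (c + Real.log ((n : ℝ) + 1)) := by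
            rw [← hsplit]; ring
        _ ≤ (N : ℝ) ^ (1 - σ) / ((n : ℝ) + 1) * (c + Real.log ((n : ℝ) + 1)) := by
            have : 0 ≤ c + Real.log ((n : ℝ) + 1) := by linarith [Real.log_nonneg hn1]
            apply mul_le_mul_of_nonneg_right _ this
            exact div_le_div_of_nonneg_right hmono hn0.le
        _ = (N : ℝ) ^ (1 - σ) * ((c + Real.log ((n : ℝ) + 1)) / ((n : ℝ) + 1)) := by ring
    calc ∑ n ∈ range N, F n
        ≤ ∑ n ∈ range N, (N : ℝ) ^ (1 - σ) * ((c + Real.log ((n : ℝ) + 1)) / ((n : ℝ) + 1)) :=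
          sum_le_sum hpt
      _ = (N : ℝ) ^ (1 - σ) * ∑ n ∈ range N, (c + Real.log ((n : ℝ) + 1)) / ((n : ℝ) + 1) := by
          rw [mul_sum]
      _ ≤ (N : ℝ) ^ (1 - σ) * (c + c * Real.log N + Real.log N ^ 2 / 2) :=
          mul_le_mul_of_nonneg_left (sum_const_add_log_div_le hc1 hN1) (Real.rpow_nonneg hN0r.le _)
  -- TAIL: `n ≥ N`, the hypothesis `|S| ≤ B ≤ N`
  obtain ⟨hgsum, hgle⟩ := tsum_const_add_log_mul_rpow_le hc1 hN1 hσ0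
  have htail : ∑' n, F (n + N) ≤ (N : ℝ) ^ (1 - σ) * ((c + Real.log N) / σ + 1 / σ ^ 2) := by
    have hpt : ∀ n : ℕ, F (n + N) ≤
        B * ((c + Real.log ((n : ℝ) + N + 1)) * ((n : ℝ) + N + 1) ^ (-(σ + 1))) := by
      intro n
      refine (hterm (n + N)).trans ?_
      have hS : ‖partialSum χ (n + N + 1)‖ ≤ B := hB _
      have hx1 : (1 : ℝ) ≤ (n : ℝ) + N + 1 := by linarith [n.cast_nonneg (α := ℝ)]
      have hlog2 : 1 + Real.log (((n + N : ℕ) : ℝ) + 2) ≤ c + Real.log ((n : ℝ) + N + 1) := by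
        have := one_add_log_add_one_le' hx1; rw [hc]; convert this using 2; push_cast; ring_nf
      have hpow : 0 ≤ (((n + N : ℕ) : ℝ) + 1) ^ (-σ - 1) := Real.rpow_nonneg (by positivity) _
      have hlog0 : 0 ≤ 1 + Real.log (((n + N : ℕ) : ℝ) + 2) := by
        have := Real.log_nonneg (show (1 : ℝ) ≤ ((n + N : ℕ) : ℝ) + 2 by
          linarith [(n + N).cast_nonneg (α := ℝ)]); linarith
      have hpow' : (((n + N : ℕ) : ℝ) + 1) ^ (-σ - 1) = ((n : ℝ) + N + 1) ^ (-(σ + 1)) := by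
        push_cast; congr 1; ring
      calc ‖partialSum χ (n + N + 1)‖ *
            ((1 + Real.log (((n + N : ℕ) : ℝ) + 2)) * (((n + N : ℕ) : ℝ) + 1) ^ (-σ - 1))
          ≤ B * ((c + Real.log ((n : ℝ) + N + 1)) * (((n + N : ℕ) : ℝ) + 1) ^ (-σ - 1)) :=
            mul_le_mul hS (mul_le_mul_of_nonneg_right hlog2 hpow) (by positivity) hB0.le
        _ = B * ((c + Real.log ((n : ℝ) + N + 1)) * ((n : ℝ) + N + 1) ^ (-(σ + 1))) := by
            rw [hpow']
    have hFN : Summable fun n => F (n + N) := (summable_nat_add_iff N).2 hFsum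
    calc ∑' n, F (n + N)
        ≤ ∑' n : ℕ, B * ((c + Real.log ((n : ℝ) + N + 1)) * ((n : ℝ) + N + 1) ^ (-(σ + 1))) :=
          hFN.tsum_le_tsum hpt (hgsum.mul_left B)
      _ = B * ∑' n : ℕ, (c + Real.log ((n : ℝ) + N + 1)) * ((n : ℝ) + N + 1) ^ (-(σ + 1)) :=
          tsum_mul_left
      _ ≤ (N : ℝ) * ((N : ℝ) ^ (-σ) * ((c + Real.log N) / σ + 1 / σ ^ 2)) := by
          apply mul_le_mul hBN hgle _ hN0r.le
          exact tsum_nonneg fun n => mul_nonneg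
            (by linarith [Real.log_nonneg (show (1:ℝ) ≤ (n:ℝ) + N + 1 by
              linarith [n.cast_nonneg (α := ℝ)])])
            (Real.rpow_nonneg (by linarith [n.cast_nonneg (α := ℝ)]) _)
      _ = (N : ℝ) ^ (1 - σ) * ((c + Real.log N) / σ + 1 / σ ^ 2) := by
          rw [← mul_assoc, show (1 : ℝ) - σ = -σ + 1 by ring, Real.rpow_add_one hN0r.ne']
          ring
  -- combine
  have htot := add_le_add hhead htail
  refine htot.trans (le_of_eq ?_)
  ring

/-- **Near `σ = 1`**: for `χ ≠ χ₀` mod `q` with `|Σ_{m≤n} χ(m)| ≤ B` (`B ≥ 1`), `r < 1` and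
`1 − r ≤ σ ≤ 1`, `‖L'(σ, χ)‖ ≤ N^{r}·(½ log²N + c log N + c + (c + log N)/(1 − r) + 1/(1 − r)²)`,
`N = ⌈B⌉`, `c = 1 + log 2`. [cite: MontgomeryVaughan2007, §11.2.1 Exercise 3 (b)] -/
theorem norm_deriv_LFunction_le_near_one_of_partialSum_le (hne : χ ≠ 1) {B : ℝ} (hB1 : 1 ≤ B)
    (hB : ∀ n, ‖partialSum χ n‖ ≤ B) {r : ℝ} (hr1 : r < 1) {σ : ℝ} (hσr : 1 - r ≤ σ)
    (hσ1 : σ ≤ 1) :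
    ‖deriv χ.LFunction σ‖ ≤
      (⌈B⌉₊ : ℝ) ^ r *
        (Real.log ⌈B⌉₊ ^ 2 / 2 + (1 + Real.log 2) * Real.log ⌈B⌉₊ + (1 + Real.log 2) +
          ((1 + Real.log 2) + Real.log ⌈B⌉₊) / (1 - r) + 1 / (1 - r) ^ 2) := by
  set N : ℕ := ⌈B⌉₊ with hNdef
  set c : ℝ := 1 + Real.log 2 with hc
  have hσ0 : 0 < σ := by linarith
  have hB0 : 0 < B := by linarith
  have hN1 : 1 ≤ N := Nat.ceil_pos.2 hB0
  have hN1r : (1 : ℝ) ≤ N := by exact_mod_cast hN1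
  have hlogN : 0 ≤ Real.log N := Real.log_nonneg hN1r
  have hc0 : 0 ≤ c := by have := Real.log_nonneg (show (1 : ℝ) ≤ 2 by norm_num); rw [hc]; linarith
  have h := norm_deriv_LFunction_ofReal_le_of_partialSum_le χ hne hB1 hB hσ0 hσ1
  have hpow : (N : ℝ) ^ (1 - σ) ≤ (N : ℝ) ^ r := Real.rpow_le_rpow_of_exponent_le hN1r (by linarith)
  have h1r : 0 < 1 - r := by linarith
  have hinv : 1 / σ ≤ 1 / (1 - r) := one_div_le_one_div_of_le h1r hσr
  have hinv2 : 1 / σ ^ 2 ≤ 1 / (1 - r) ^ 2 :=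
    one_div_le_one_div_of_le (by positivity) (pow_le_pow_left₀ h1r.le hσr 2)
  have hdiv : (c + Real.log N) / σ ≤ (c + Real.log N) / (1 - r) := by
    rw [div_eq_mul_one_div, div_eq_mul_one_div (c + Real.log N)]
    exact mul_le_mul_of_nonneg_left hinv (by positivity)
  have hbr0 : 0 ≤ Real.log N ^ 2 / 2 + c * Real.log N + c + (c + Real.log N) / σ + 1 / σ ^ 2 := by
    positivity
  calc ‖deriv χ.LFunction σ‖
      ≤ (N : ℝ) ^ (1 - σ) * (Real.log N ^ 2 / 2 + c * Real.log N + c + (c + Real.log N) / σ +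
          1 / σ ^ 2) := h
    _ ≤ (N : ℝ) ^ r * (Real.log N ^ 2 / 2 + c * Real.log N + c + (c + Real.log N) / (1 - r) +
          1 / (1 - r) ^ 2) := by
        apply mul_le_mul hpow _ hbr0 (Real.rpow_nonneg (by linarith) _)
        linarith

end Literature.NumberTheory.LFunctions.DirichletAbel

end
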